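import Summits.ValiantsHypothesis.ValiantsHypothesis.Theorems.KPlusLogSqLawStaticTridiagonalPerturb

/-!
# Route «KPlusLogSqLaw» — dominant chains of a full STATIC TRIDIAGONAL design have `O(m log m)` terms, UNCONDITIONALLY

HONEST FRAMING.  Helper toward the crux `WeakLifting` (item `stmt-ValiantsHypothesis-19561`, route `KPlusLogSqLaw`, cell `pub-symmetroid`,
seat val-sym-lift-p3 g7, 2026-08-27) on the line of its witness-plan stub `stub_tridiagonalSectorB`: the TROPICAL side of the STATIC
tridiagonal sub-sector, last step (T5b) of HOME/val-sym-lift-p3/g6/FOLD-LEMMA-AND-WIDTH2-TRELLIS-liftp3g6.md §A3.  The conditional law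
`StaticTridiagonal.chain_le_of_static_tridiagonal` (p527426) bounds every chain of distinct consecutive dominant terms of a full static
tridiagonal dominance design of size `m` by `66 · (m−1) · (⌊log₂ (m−1)⌋ + 2)` PROVIDED no alternating interval sum of the design's item lines
vanishes identically.  Here that proviso is DISCHARGED: after scaling valuations and slopes by `N = 2^(m²+m+2)` and adding `2^(i·m+j)` to the
valuation of every off-diagonal entry `(i, j)` (dominance persists, `isDominant_scale_perturb`, p527844), the alternating sum of the new item
intercepts over any item interval `(u, w]` is `N·A − D` with `A ∈ ℤ` and `D` a signed sum of DISTINCT powers of two whose least exponent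
`u·m + u + 1` occurs exactly once, so `D ≠ 0` and `|D| < N`, whence `N·A − D ≠ 0`.  RESULT (`StaticTridiagonal.chain_le`): **for every full
static tridiagonal dominance design of format `(m, K)` (an entry `(i, j)` carries a class iff `|i − j| ≤ 1`, and then exactly the class
`cls i j`), every chain of distinct consecutive `IsDominant` terms at strictly increasing integer slopes has at most
`66 · (m−1) · (⌊log₂ (m−1)⌋ + 2)` steps** — no sign hypothesis, no non-degeneracy hypothesis; in particular every alternating chain counted by
`TropRootLawAt` on such a design obeys the bound (`StaticTridiagonal.chain_le_of_alternating`).  This sharpens, on the static bandwidth-one slice,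
the sector's polynomial law `IntervalOpt.chain_le_banded` (`(mK+1)(2m)^5`) and `tropicalB_hessenberg` to `O(m log m)`, uniformly in `K` and in
the exponents.  Nothing here asserts anything about `WeakLifting`, `TropicalB`, `KPlusLogSqLaw`, the stub in its window (its REAL side),
`MatrixDescartes` (stmt-ValiantsHypothesis-18050) or `VP ≠ VNP`.
[folklore] (2-adic valuation of a signed sum of distinct powers of two; scaling/perturbation bookkeeping).
-/

set_option linter.dupNamespace false
set_option autoImplicit false

namespace Summit.ValiantsHypothesis.ValiantsHypothesis.Theorems.KPlusLogSqLaw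

open Finset Classical
open Summit.ValiantsHypothesis.ValiantsHypothesis.Theorems.MatrixDescartes.Negative

namespace StaticTridiagonal

variable {m K : ℕ}

/-! ## 1. The perturbation table and its arithmetic -/

/-- the off-diagonal perturbation `δ i j = 2^(i·m + j)` (`i ≠ j`), `0` on the diagonal, is non-negative (the table `δ` is passed with its defining
equation `hδ`, so that no definition is introduced). [folklore] -/
theorem pert_nonneg {δ : Fin m → Fin m → ℤ} (hδ : ∀ i j, δ i j = if i = j then 0 else 2 ^ ((i : ℕ) * m + j)) (i j : Fin m) :
    0 ≤ δ i j := by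
  rw [hδ]; split_ifs <;> positivity

/-- the perturbation is at most `2^(m²)`. [folklore] -/
theorem pert_le {δ : Fin m → Fin m → ℤ} (hδ : ∀ i j, δ i j = if i = j then 0 else 2 ^ ((i : ℕ) * m + j)) (i j : Fin m) :
    δ i j ≤ 2 ^ (m ^ 2) := by
  rw [hδ]
  split_ifs
  · positivity
  · have hi : (i : ℕ) + 1 ≤ m := i.isLt
    have hj : (j : ℕ) + 1 ≤ m := j.isLt
    have h1 : (i : ℕ) * m + j ≤ m ^ 2 := by nlinarith
    exact_mod_cast Nat.pow_le_pow_right two_pos h1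

/-- the scaling factor `N = 2^(m²+m+2)` dominates `m · 2^(m²)`. [folklore] -/
theorem scale_gt (m : ℕ) : (m : ℤ) * 2 ^ (m ^ 2) < 2 ^ (m ^ 2 + m + 2) := by
  have h1 : (m : ℤ) < 2 ^ (m + 2) := by
    have : m < 2 ^ (m + 2) := (Nat.lt_two_pow_self).trans (Nat.pow_lt_pow_right one_lt_two (by omega))
    exact_mod_cast this
  have h2 : (2 : ℤ) ^ (m ^ 2 + m + 2) = 2 ^ (m ^ 2) * 2 ^ (m + 2) := by rw [pow_add, pow_add, pow_add]; ring
  rw [h2]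
  have h3 : (0 : ℤ) < 2 ^ (m ^ 2) := by positivity
  nlinarith

/-- valuations read off a class table are integers. [folklore] -/
theorem vN_int (cls : Fin m → Fin m → Fin K) (v : Fin m → Fin m → Fin K → ℤ) (r c : ℕ) : ∃ z : ℤ, vN cls v r c = (z : ℝ) := by
  unfold vN
  split_ifs
  · exact ⟨_, rfl⟩
  · exact ⟨0, by simp⟩

/-- item intercepts are integers. [folklore] -/
theorem itemIcpt_int (cls : Fin m → Fin m → Fin K) (v : Fin m → Fin m → Fin K → ℤ) (t : ℕ) :
    ∃ z : ℤ, itemIcpt cls v t = (z : ℝ) := by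
  obtain ⟨a, ha⟩ := vN_int cls v t (t - 1)
  obtain ⟨b, hb⟩ := vN_int cls v (t - 1) t
  obtain ⟨c, hc⟩ := vN_int cls v (t - 1) (t - 1)
  obtain ⟨e, he⟩ := vN_int cls v t t
  refine ⟨-(a + b - c - e), ?_⟩
  unfold itemIcpt
  rw [ha, hb, hc, he]
  push_cast
  ring

/-- the perturbed item intercept of an item `1 ≤ t ≤ m − 1` is `N · itemIcpt − (2^(t·m + (t−1)) + 2^((t−1)·m + t))` (the two off-diagonal
entries of the swap `t`; the diagonal perturbations vanish). [folklore] -/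
theorem itemIcpt_pert (cls : Fin m → Fin m → Fin K) (v : Fin m → Fin m → Fin K → ℤ) {δ : Fin m → Fin m → ℤ}
    (hδ : ∀ i j, δ i j = if i = j then 0 else 2 ^ ((i : ℕ) * m + j)) (N : ℤ) {t : ℕ} (ht1 : 1 ≤ t) (htm : t ≤ m - 1) (hm : 2 ≤ m) :
    itemIcpt cls (fun i j l => N * v i j l + δ i j) t =
      (N : ℝ) * itemIcpt cls v t - ((2 ^ (t * m + (t - 1)) + 2 ^ ((t - 1) * m + t) : ℤ) : ℤ) := by
  rw [itemIcpt_perturb]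
  have h1 : t < m := by omega
  have h2 : t - 1 < m := by omega
  rw [dif_pos ⟨h1, h2⟩, dif_pos ⟨h2, h1⟩, dif_pos ⟨h2, h2⟩, dif_pos ⟨h1, h1⟩]
  have e1 : δ ⟨t, h1⟩ ⟨t - 1, h2⟩ = 2 ^ (t * m + (t - 1)) := by
    rw [hδ, if_neg (by intro h; have := congrArg Fin.val h; simp at this; omega)]
  have e2 : δ ⟨t - 1, h2⟩ ⟨t, h1⟩ = 2 ^ ((t - 1) * m + t) := by
    rw [hδ, if_neg (by intro h; have := congrArg Fin.val h; simp at this; omega)]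
  have e3 : δ ⟨t - 1, h2⟩ ⟨t - 1, h2⟩ = 0 := by rw [hδ, if_pos rfl]
  have e4 : δ ⟨t, h1⟩ ⟨t, h1⟩ = 0 := by rw [hδ, if_pos rfl]
  rw [e1, e2, e3, e4]
  push_cast
  ring

/-- `2^(b+1)` divides `2^e` once `b < e`. [folklore] -/
theorem two_pow_succ_dvd {b e : ℕ} (h : b < e) : (2 : ℤ) ^ (b + 1) ∣ 2 ^ e :=
  pow_dvd_pow 2 (by omega)

/-- **the alternating perturbation sum over an item interval `(u, w]` does not vanish**: its least power of two, `2^(u·m+u+1)` (item `u+1`, entry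
`(u, u+1)`), occurs exactly once. [folklore] -/
theorem pertSum_ne_zero {u w : ℕ} (huw : u < w) (hm : 2 ≤ m) :
    ∑ t ∈ Ioc u w, (-1 : ℤ) ^ t * (2 ^ (t * m + (t - 1)) + 2 ^ ((t - 1) * m + t)) ≠ 0 := by
  -- split off the item `u + 1`
  have hsplit : Ioc u w = insert (u + 1) (Ioc (u + 1) w) := by
    ext t; simp only [mem_Ioc, mem_insert]; omega
  have hnot : u + 1 ∉ Ioc (u + 1) w := by simp
  set b := u * m + u + 1 with hb
  -- every summand except `(-1)^(u+1) · 2^b` is divisible by `2^(b+1)`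
  have hdvd : (2 : ℤ) ^ (b + 1) ∣ ∑ t ∈ Ioc u w, (-1 : ℤ) ^ t * (2 ^ (t * m + (t - 1)) + 2 ^ ((t - 1) * m + t)) -
      (-1) ^ (u + 1) * 2 ^ b := by
    rw [hsplit, sum_insert hnot]
    have e0 : (-1 : ℤ) ^ (u + 1) * (2 ^ ((u + 1) * m + (u + 1 - 1)) + 2 ^ ((u + 1 - 1) * m + (u + 1))) +
        ∑ t ∈ Ioc (u + 1) w, (-1 : ℤ) ^ t * (2 ^ (t * m + (t - 1)) + 2 ^ ((t - 1) * m + t)) - (-1) ^ (u + 1) * 2 ^ b =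
        (-1 : ℤ) ^ (u + 1) * 2 ^ ((u + 1) * m + u) +
          ∑ t ∈ Ioc (u + 1) w, (-1 : ℤ) ^ t * (2 ^ (t * m + (t - 1)) + 2 ^ ((t - 1) * m + t)) := by
      rw [Nat.add_sub_cancel, show u * m + (u + 1) = b by rw [hb]; ring]
      ring
    rw [e0]
    refine dvd_add (Dvd.dvd.mul_left (two_pow_succ_dvd (by rw [hb]; nlinarith)) _) (dvd_sum fun t ht => ?_)
    have ht' := mem_Ioc.mp ht
    refine Dvd.dvd.mul_left (dvd_add (two_pow_succ_dvd ?_) (two_pow_succ_dvd ?_)) _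
    · rw [hb]
      have : (u + 2) * m + (u + 1) ≤ t * m + (t - 1) := by
        have h1 : (u + 2) * m ≤ t * m := Nat.mul_le_mul_right _ (by omega)
        omega
      nlinarith
    · rw [hb]
      have : (u + 1) * m + (u + 2) ≤ (t - 1) * m + t := by
        have h1 : (u + 1) * m ≤ (t - 1) * m := Nat.mul_le_mul_right _ (by omega)
        omega
      nlinarith
  intro h0
  rw [h0, zero_sub, dvd_neg] at hdvd
  have h2 : (2 : ℤ) ^ (b + 1) ∣ 2 ^ b := by
    have hu : IsUnit ((-1 : ℤ) ^ (u + 1)) := (isUnit_neg_one (α := ℤ)).pow _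
    exact (hu.dvd_mul_left).mp hdvd
  have h3 := Int.le_of_dvd (by positivity) h2
  have h4 : (2 : ℤ) ^ b < 2 ^ (b + 1) := pow_lt_pow_right₀ (by norm_num) (by omega)
  omega

/-- the alternating perturbation sum is small: `|·| ≤ m · 2^(m²+1) < 2^(m²+m+2)` for `w ≤ m − 1`. [folklore] -/
theorem abs_pertSum_lt {u w : ℕ} (hw : w ≤ m - 1) :
    |∑ t ∈ Ioc u w, (-1 : ℤ) ^ t * (2 ^ (t * m + (t - 1)) + 2 ^ ((t - 1) * m + t))| < 2 ^ (m ^ 2 + m + 2) := by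
  have hterm : ∀ t ∈ Ioc u w, |(-1 : ℤ) ^ t * ((2 : ℤ) ^ (t * m + (t - 1)) + 2 ^ ((t - 1) * m + t))| ≤ 2 ^ (m ^ 2 + 1) := by
    intro t ht
    have ht' := mem_Ioc.mp ht
    rw [abs_mul, abs_pow, abs_neg, abs_one, one_pow, one_mul]
    rw [abs_of_nonneg (by positivity)]
    have htm : t + 1 ≤ m := by omega
    have e1 : t * m + (t - 1) ≤ m ^ 2 := by nlinarith [Nat.sub_le t 1]
    have e2 : (t - 1) * m + t ≤ m ^ 2 := by nlinarith [Nat.sub_le t 1]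
    have h1 : (2 : ℤ) ^ (t * m + (t - 1)) ≤ 2 ^ (m ^ 2) := pow_le_pow_right₀ (by norm_num) e1
    have h2 : (2 : ℤ) ^ ((t - 1) * m + t) ≤ 2 ^ (m ^ 2) := pow_le_pow_right₀ (by norm_num) e2
    rw [pow_succ]
    linarith
  have h1 : |∑ t ∈ Ioc u w, (-1 : ℤ) ^ t * ((2 : ℤ) ^ (t * m + (t - 1)) + 2 ^ ((t - 1) * m + t))| ≤
      ∑ t ∈ Ioc u w, |(-1 : ℤ) ^ t * ((2 : ℤ) ^ (t * m + (t - 1)) + 2 ^ ((t - 1) * m + t))| := abs_sum_le_sum_abs _ _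
  have h2 : ∑ t ∈ Ioc u w, |(-1 : ℤ) ^ t * ((2 : ℤ) ^ (t * m + (t - 1)) + 2 ^ ((t - 1) * m + t))| ≤
      ∑ _t ∈ Ioc u w, (2 : ℤ) ^ (m ^ 2 + 1) := sum_le_sum hterm
  rw [sum_const, Nat.card_Ioc, nsmul_eq_mul] at h2
  have h3 : ((w - u : ℕ) : ℤ) * 2 ^ (m ^ 2 + 1) ≤ (m : ℤ) * 2 ^ (m ^ 2 + 1) := by
    have : ((w - u : ℕ) : ℤ) ≤ m := by
      have : w - u ≤ m := by omega
      exact_mod_cast this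
    have h0 : (0 : ℤ) ≤ 2 ^ (m ^ 2 + 1) := by positivity
    nlinarith
  have h4 : (m : ℤ) * 2 ^ (m ^ 2 + 1) < 2 ^ (m ^ 2 + m + 2) := by
    have e : (2 : ℤ) ^ (m ^ 2 + m + 2) = 2 ^ (m ^ 2 + 1) * 2 ^ (m + 1) := by rw [← pow_add]; congr 1; ring
    have hm : (m : ℤ) < 2 ^ (m + 1) := by
      have : m < 2 ^ (m + 1) := (Nat.lt_two_pow_self).trans (Nat.pow_lt_pow_right one_lt_two (by omega))
      exact_mod_cast this
    rw [e]
    have h0 : (0 : ℤ) < 2 ^ (m ^ 2 + 1) := by positivity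
    nlinarith
  linarith

/-- `N·A − D ≠ 0` when `D ≠ 0` and `|D| < N`. [folklore] -/
theorem scale_sub_ne_zero {N A D : ℤ} (hD : D ≠ 0) (hDN : |D| < N) : N * A - D ≠ 0 := by
  intro h
  have hN : 0 < N := lt_of_le_of_lt (abs_nonneg D) hDN
  rcases eq_or_ne A 0 with hA | hA
  · rw [hA, mul_zero, zero_sub, neg_eq_zero] at h; exact hD h
  · have h1 : N ≤ |N * A| := by
      rw [abs_mul, abs_of_pos hN]
      have : 1 ≤ |A| := Int.one_le_abs hA
      nlinarith
    rw [sub_eq_zero] at h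
    rw [h] at h1
    linarith

/-! ## 2. The perturbed design is non-degenerate -/

/-- **the alternating interval sums of the perturbed item intercepts never vanish** (hypothesis `hG` of `chain_le_of_static_tridiagonal` for the
scaled-perturbed design, intercept disjunct). [folklore] -/
theorem altIcpt_pert_ne_zero (cls : Fin m → Fin m → Fin K) (v : Fin m → Fin m → Fin K → ℤ) {δ : Fin m → Fin m → ℤ}
    (hδ : ∀ i j, δ i j = if i = j then 0 else 2 ^ ((i : ℕ) * m + j)) {u w : ℕ} (huw : u < w) (hw : w ≤ m - 1) :
    ∑ t ∈ Ioc u w, (-1 : ℝ) ^ t * itemIcpt cls (fun i j l => (2 : ℤ) ^ (m ^ 2 + m + 2) * v i j l + δ i j) t ≠ 0 := by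
  have hm : 2 ≤ m := by omega
  set N : ℤ := 2 ^ (m ^ 2 + m + 2) with hN
  -- integrality of the original intercepts
  choose z hz using itemIcpt_int cls v
  have hsum : ∑ t ∈ Ioc u w, (-1 : ℝ) ^ t * itemIcpt cls (fun i j l => N * v i j l + δ i j) t =
      ((N * (∑ t ∈ Ioc u w, (-1 : ℤ) ^ t * z t) -
        ∑ t ∈ Ioc u w, (-1 : ℤ) ^ t * (2 ^ (t * m + (t - 1)) + 2 ^ ((t - 1) * m + t)) : ℤ) : ℝ) := by
    push_cast
    rw [mul_sum, ← sum_sub_distrib]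
    refine sum_congr rfl fun t ht => ?_
    have ht' := mem_Ioc.mp ht
    rw [itemIcpt_pert cls v hδ N (Nat.one_le_of_lt ht'.1) (ht'.2.trans hw) hm, hz t]
    push_cast
    ring
  rw [hsum]
  exact_mod_cast scale_sub_ne_zero (pertSum_ne_zero huw hm) (abs_pertSum_lt hw)

/-! ## 3. The unconditional law -/

/-- **DOMINANT CHAINS OF A FULL STATIC TRIDIAGONAL DESIGN HAVE `O(m log m)` TERMS** (unconditional): for a dominance design `(d, v, ε)` of format
`(m, K)` in which an entry `(i, j)` carries a class iff `|i − j| ≤ 1`, and then exactly the class `cls i j`, every chain of distinct consecutive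
`IsDominant` terms at strictly increasing integer slopes has at most `66 · (m−1) · (⌊log₂ (m−1)⌋ + 2)` steps. [folklore] -/
theorem chain_le (d : Fin K → ℕ) (v ε : Fin m → Fin m → Fin K → ℤ) (cls : Fin m → Fin m → Fin K)
    (hε : ∀ i j l, ε i j l ≠ 0 ↔ (((i : ℕ) ≤ j + 1 ∧ (j : ℕ) ≤ i + 1) ∧ l = cls i j))
    (n : ℕ) (θ : Fin (n + 1) → ℤ) (p : Fin (n + 1) → Equiv.Perm (Fin m) × (Fin m → Fin K)) (hθ : StrictMono θ)
    (hdom : ∀ k, IsDominant d v ε (θ k) (p k)) (hne : ∀ k : Fin n, p k.castSucc ≠ p k.succ) :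
    n ≤ 66 * (m - 1) * (Nat.log 2 (m - 1) + 2) := by
  set N : ℤ := 2 ^ (m ^ 2 + m + 2) with hN
  have hNpos : 0 < N := by positivity
  -- the perturbation table (kept as a local function; its defining equation is `rfl`)
  set δ : Fin m → Fin m → ℤ := fun i j => if i = j then 0 else 2 ^ ((i : ℕ) * m + j) with hδ'
  have hδ : ∀ i j, δ i j = if i = j then 0 else 2 ^ ((i : ℕ) * m + j) := fun i j => rfl
  refine chain_le_of_static_tridiagonal d (fun i j l => N * v i j l + δ i j) ε cls hε
    (fun u w huw hw => Or.inr (altIcpt_pert_ne_zero cls v hδ huw hw)) n (fun k => N * θ k) p (strictMono_mul hθ hNpos)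
    (fun k => ?_) hne
  exact isDominant_scale_perturb d v ε δ N (2 ^ (m ^ 2)) (θ k) (fun i j => pert_nonneg hδ i j) (fun i j => pert_le hδ i j)
    (scale_gt m) (hdom k)

/-- **corollary in `TropRootLawAt` currency**: an ALTERNATING chain of dominant terms of a full static tridiagonal design (consecutive term signs of
opposite sign, as counted by `TropicalCensus.TropRootLawAt`) has at most `66 · (m−1) · (⌊log₂ (m−1)⌋ + 2)` alternations — consecutive terms of an
alternating chain are distinct. [folklore] -/
theorem chain_le_of_alternating (d : Fin K → ℕ) (v ε : Fin m → Fin m → Fin K → ℤ) (cls : Fin m → Fin m → Fin K)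
    (hε : ∀ i j l, ε i j l ≠ 0 ↔ (((i : ℕ) ≤ j + 1 ∧ (j : ℕ) ≤ i + 1) ∧ l = cls i j))
    (n : ℕ) (θ : Fin (n + 1) → ℤ) (p : Fin (n + 1) → Equiv.Perm (Fin m) × (Fin m → Fin K)) (hθ : StrictMono θ)
    (hdom : ∀ k, IsDominant d v ε (θ k) (p k))
    (halt : ∀ k : Fin n, termSign ε (p k.castSucc) * termSign ε (p k.succ) < 0) :
    n ≤ 66 * (m - 1) * (Nat.log 2 (m - 1) + 2) := by
  refine chain_le d v ε cls hε n θ p hθ hdom fun k heq => ?_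
  have h := halt k
  rw [heq] at h
  exact absurd h (not_lt.mpr (mul_self_nonneg _))

end StaticTridiagonal

end Summit.ValiantsHypothesis.ValiantsHypothesis.Theorems.KPlusLogSqLaw
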